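import Summits.Parity.GeneralizedHardyLittlewood.Theorems.LiouvilleShiftedTablesSieveToMAvgFunctional

/-!
# Sieve glue for `SieveToMAvg`, part 5: the fourth-moment bound for bilinear forms

Support file for item stmt-Parity-14274 (route `LiouvilleShiftedTables`).  The Type-II input of
the route (`DilatedTableChowla`) controls the fourth moment `tr (M Mᵀ)² = ∑_{a,a'} (∑_b M_{ab} M_{a'b})²`
of the class-restricted shifted multiplication tables `M`.  A bilinear form is bounded through it by
two applications of the Cauchy–Schwarz inequality (no spectral theory):

  `|∑_{a,b} α_a M_{ab} β_b| ≤ ‖α‖₂ ‖β‖₂ · (∑_{a,a'} (∑_b M_{ab} M_{a'b})²)^{1/4}`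

(`‖Mβ‖² = ∑_{b,b'} β_b β_{b'} G_{bb'}`, `G = MᵀM`, and `∑_{b,b'} G_{bb'}² = tr (MᵀM)² = tr (MMᵀ)²`).
We also record the Hölder step over the moduli used with the `ℓ¹`-form of the crux:
`∑_q x_q ≤ (∑_q q³ x_q⁴)^{1/4} (∑_q q⁻¹)^{3/4}` for `x_q ≥ 0`.
-/

namespace Summit.Parity.GeneralizedHardyLittlewood.Theorems.SieveToMAvg

open Finset Real

/-! ### Two Cauchy–Schwarz steps -/

/-- The fourth-moment functional `F(M) = ∑_{a,a' ∈ A} (∑_{b ∈ B} M_{ab} M_{a'b})²`. [folklore] -/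
noncomputable def fourthMoment (A B : Finset ℕ) (M : ℕ → ℕ → ℝ) : ℝ :=
  ∑ a ∈ A, ∑ a' ∈ A, (∑ b ∈ B, M a b * M a' b) ^ 2

/-- `F(M) ≥ 0`. [folklore] -/
theorem fourthMoment_nonneg (A B : Finset ℕ) (M : ℕ → ℕ → ℝ) : 0 ≤ fourthMoment A B M :=
  Finset.sum_nonneg fun _ _ => Finset.sum_nonneg fun _ _ => sq_nonneg _

/-- `∑_{b,b'} (∑_a M_{ab} M_{ab'})² = ∑_{a,a'} (∑_b M_{ab} M_{a'b})²` (both are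
`∑_{a,a',b,b'} M_{ab} M_{ab'} M_{a'b} M_{a'b'}`). [folklore] -/
theorem sum_sq_gram_eq_fourthMoment (A B : Finset ℕ) (M : ℕ → ℕ → ℝ) :
    ∑ b ∈ B, ∑ b' ∈ B, (∑ a ∈ A, M a b * M a b') ^ 2 = fourthMoment A B M := by
  unfold fourthMoment
  -- expand both squares as double sums
  have hL : ∀ b b', (∑ a ∈ A, M a b * M a b') ^ 2 =
      ∑ a ∈ A, ∑ a' ∈ A, M a b * M a b' * (M a' b * M a' b') := by
    intro b b'
    rw [sq, Finset.sum_mul_sum]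
  have hR : ∀ a a', (∑ b ∈ B, M a b * M a' b) ^ 2 =
      ∑ b ∈ B, ∑ b' ∈ B, M a b * M a' b * (M a b' * M a' b') := by
    intro a a'
    rw [sq, Finset.sum_mul_sum]
  simp_rw [hL, hR]
  -- now reorder the four sums: (b, b', a, a') ↦ (a, a', b, b')
  calc ∑ b ∈ B, ∑ b' ∈ B, ∑ a ∈ A, ∑ a' ∈ A, M a b * M a b' * (M a' b * M a' b')
      = ∑ b ∈ B, ∑ a ∈ A, ∑ b' ∈ B, ∑ a' ∈ A, M a b * M a b' * (M a' b * M a' b') := by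
        refine Finset.sum_congr rfl fun b _ => ?_
        rw [Finset.sum_comm]
    _ = ∑ a ∈ A, ∑ b ∈ B, ∑ b' ∈ B, ∑ a' ∈ A, M a b * M a b' * (M a' b * M a' b') := by
        rw [Finset.sum_comm]
    _ = ∑ a ∈ A, ∑ b ∈ B, ∑ a' ∈ A, ∑ b' ∈ B, M a b * M a b' * (M a' b * M a' b') := by
        refine Finset.sum_congr rfl fun a _ => Finset.sum_congr rfl fun b _ => ?_
        rw [Finset.sum_comm]
    _ = ∑ a ∈ A, ∑ a' ∈ A, ∑ b ∈ B, ∑ b' ∈ B, M a b * M a b' * (M a' b * M a' b') := by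
        refine Finset.sum_congr rfl fun a _ => ?_
        rw [Finset.sum_comm]
    _ = ∑ a ∈ A, ∑ a' ∈ A, ∑ b ∈ B, ∑ b' ∈ B, M a b * M a' b * (M a b' * M a' b') := by
        refine Finset.sum_congr rfl fun a _ => Finset.sum_congr rfl fun a' _ =>
          Finset.sum_congr rfl fun b _ => Finset.sum_congr rfl fun b' _ => ?_
        ring

/-- `‖Mβ‖₂² ≤ ‖β‖₂² · F(M)^{1/2}`: the square of `∑_a (∑_b M_{ab} β_b)²` is at most
`(∑_b β_b²)² F(M)`. [folklore] -/
theorem sum_sq_mulVec_sq_le (A B : Finset ℕ) (M : ℕ → ℕ → ℝ) (β : ℕ → ℝ) :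
    (∑ a ∈ A, (∑ b ∈ B, M a b * β b) ^ 2) ^ 2 ≤ (∑ b ∈ B, β b ^ 2) ^ 2 * fourthMoment A B M := by
  -- `∑_a (Mβ)_a² = ∑_{(b,b')} β_b β_{b'} G_{bb'}`
  set G : ℕ → ℕ → ℝ := fun b b' => ∑ a ∈ A, M a b * M a b' with hG
  have h1 : ∑ a ∈ A, (∑ b ∈ B, M a b * β b) ^ 2 =
      ∑ p ∈ B ×ˢ B, (β p.1 * β p.2) * G p.1 p.2 := by
    rw [Finset.sum_product]
    simp only [hG, Finset.mul_sum]
    have : ∀ a ∈ A, (∑ b ∈ B, M a b * β b) ^ 2 =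
        ∑ b ∈ B, ∑ b' ∈ B, β b * β b' * (M a b * M a b') := by
      intro a _
      rw [sq, Finset.sum_mul_sum]
      refine Finset.sum_congr rfl fun b _ => Finset.sum_congr rfl fun b' _ => ?_
      ring
    rw [Finset.sum_congr rfl this, Finset.sum_comm]
    refine Finset.sum_congr rfl fun b _ => ?_
    rw [Finset.sum_comm]
  rw [h1]
  -- Cauchy–Schwarz over pairs
  refine (Finset.sum_mul_sq_le_sq_mul_sq (B ×ˢ B) (fun p => β p.1 * β p.2) (fun p => G p.1 p.2)).trans ?_
  have h2 : ∑ p ∈ B ×ˢ B, (β p.1 * β p.2) ^ 2 = (∑ b ∈ B, β b ^ 2) ^ 2 := by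
    rw [Finset.sum_product, sq (∑ b ∈ B, β b ^ 2), Finset.sum_mul_sum]
    refine Finset.sum_congr rfl fun b _ => Finset.sum_congr rfl fun b' _ => ?_
    ring
  have h3 : ∑ p ∈ B ×ˢ B, (G p.1 p.2) ^ 2 = fourthMoment A B M := by
    rw [Finset.sum_product]
    exact sum_sq_gram_eq_fourthMoment A B M
  rw [h2, h3]

/-- **The fourth-moment bound for bilinear forms**:
`|∑_{a∈A} ∑_{b∈B} α_a M_{ab} β_b| ≤ √(∑ α_a²) √(∑ β_b²) F(M)^{1/4}`. [folklore] -/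
theorem abs_bilinear_le (A B : Finset ℕ) (M : ℕ → ℕ → ℝ) (α β : ℕ → ℝ) :
    |∑ a ∈ A, ∑ b ∈ B, α a * M a b * β b| ≤
      Real.sqrt (∑ a ∈ A, α a ^ 2) * Real.sqrt (∑ b ∈ B, β b ^ 2) *
        (fourthMoment A B M) ^ ((1 : ℝ) / 4) := by
  set y : ℕ → ℝ := fun a => ∑ b ∈ B, M a b * β b with hy
  have hS : ∑ a ∈ A, ∑ b ∈ B, α a * M a b * β b = ∑ a ∈ A, α a * y a := by
    refine Finset.sum_congr rfl fun a _ => ?_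
    rw [hy, Finset.mul_sum]
    exact Finset.sum_congr rfl fun b _ => by ring
  rw [hS]
  have hF0 : 0 ≤ fourthMoment A B M := fourthMoment_nonneg A B M
  have hα0 : 0 ≤ ∑ a ∈ A, α a ^ 2 := Finset.sum_nonneg fun _ _ => sq_nonneg _
  have hβ0 : 0 ≤ ∑ b ∈ B, β b ^ 2 := Finset.sum_nonneg fun _ _ => sq_nonneg _
  have hy0 : 0 ≤ ∑ a ∈ A, y a ^ 2 := Finset.sum_nonneg fun _ _ => sq_nonneg _
  -- first Cauchy–Schwarz
  have h1 : (∑ a ∈ A, α a * y a) ^ 2 ≤ (∑ a ∈ A, α a ^ 2) * ∑ a ∈ A, y a ^ 2 :=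
    Finset.sum_mul_sq_le_sq_mul_sq A α y
  -- second step: `∑ y² ≤ (∑ β²) √F`
  have h2 : ∑ a ∈ A, y a ^ 2 ≤ (∑ b ∈ B, β b ^ 2) * Real.sqrt (fourthMoment A B M) := by
    have h := sum_sq_mulVec_sq_le A B M β
    have h' := Real.sqrt_le_sqrt h
    rwa [Real.sqrt_sq hy0, Real.sqrt_mul (sq_nonneg _), Real.sqrt_sq hβ0] at h'
  have h3 : (∑ a ∈ A, α a * y a) ^ 2 ≤
      (∑ a ∈ A, α a ^ 2) * ((∑ b ∈ B, β b ^ 2) * Real.sqrt (fourthMoment A B M)) :=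
    h1.trans (mul_le_mul_of_nonneg_left h2 hα0)
  have h4 := Real.sqrt_le_sqrt h3
  rw [Real.sqrt_sq_eq_abs, Real.sqrt_mul hα0, Real.sqrt_mul hβ0] at h4
  have h5 : Real.sqrt (Real.sqrt (fourthMoment A B M)) = (fourthMoment A B M) ^ ((1 : ℝ) / 4) := by
    rw [Real.sqrt_eq_rpow, Real.sqrt_eq_rpow, ← Real.rpow_mul hF0]
    norm_num
  rw [h5] at h4
  simpa only [mul_assoc] using h4

/-! ### Hölder over the moduli -/

/-- **Hölder with exponents `(4, 4/3)` against the weights `q³`**: for `x_q ≥ 0` on a finite set of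
positive integers, `∑_q x_q ≤ (∑_q q³ x_q⁴)^{1/4} · (∑_q q⁻¹)^{3/4}`. [folklore] -/
theorem sum_le_holder_cube (s : Finset ℕ) (hs : ∀ q ∈ s, 1 ≤ q) (xq : ℕ → ℝ) (hx : ∀ q ∈ s, 0 ≤ xq q) :
    ∑ q ∈ s, xq q ≤
      (∑ q ∈ s, (q : ℝ) ^ 3 * xq q ^ 4) ^ ((1 : ℝ) / 4) * (∑ q ∈ s, (q : ℝ)⁻¹) ^ ((3 : ℝ) / 4) := by
  have hpq : Real.HolderConjugate 4 (4 / 3) := by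
    refine ⟨by norm_num, by norm_num, by norm_num⟩
  -- write `x_q = (q^{3/4} x_q) · q^{-3/4}`
  set f : ℕ → ℝ := fun q => (q : ℝ) ^ ((3 : ℝ) / 4) * xq q with hf
  set g : ℕ → ℝ := fun q => (q : ℝ) ^ (-(3 : ℝ) / 4) with hg
  have hfg : ∀ q ∈ s, xq q = f q * g q := by
    intro q hq
    have hq0 : (0 : ℝ) < q := by exact_mod_cast hs q hq
    simp only [hf, hg]
    rw [mul_comm ((q : ℝ) ^ ((3 : ℝ) / 4)) (xq q), mul_assoc, ← Real.rpow_add hq0]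
    norm_num
  rw [Finset.sum_congr rfl hfg]
  refine (Real.inner_le_Lp_mul_Lq s f g hpq).trans_eq ?_
  congr 1
  · congr 1
    refine Finset.sum_congr rfl fun q hq => ?_
    have hq0 : (0 : ℝ) ≤ q := Nat.cast_nonneg q
    simp only [hf]
    rw [abs_of_nonneg (mul_nonneg (Real.rpow_nonneg hq0 _) (hx q hq)), Real.mul_rpow (Real.rpow_nonneg hq0 _) (hx q hq),
      ← Real.rpow_mul hq0]
    norm_num
  · congr 1
    · refine Finset.sum_congr rfl fun q hq => ?_
      have hq0 : (0 : ℝ) < q := by exact_mod_cast hs q hq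
      simp only [hg]
      rw [abs_of_nonneg (Real.rpow_nonneg hq0.le _), ← Real.rpow_mul hq0.le]
      norm_num
      exact Real.rpow_neg_one (q : ℝ)
    · norm_num

end Summit.Parity.GeneralizedHardyLittlewood.Theorems.SieveToMAvg
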